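import Summits.CriticalPhenomena.Ising3D.IsingColumnFaceL11CensusDistinctAssembly
import Summits.CriticalPhenomena.Ising3D.IsingColumnFaceL11CensusSegmentTrgD

/-!
# The catalogue census of §7.3 as kernel facts, IX: the distinct-values machine, part 7 — the `TRG` theorems: the
description counts of §7.3 are VALUE counts; the sharp minimum separation (cell `pub-ising3x`, seat recog-1;
paper §1.6 / §7.3)

HONEST FRAMING: lottery ticket; floor = tightest certified 3D Ising CFT bounds; no exact-solution
claim without a proof. Island framing: certified exclusion region at stated derivative order and
assumptions; not a determination of the 3D Ising critical exponents beyond that.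

§7.3 prints «trigonometric/Γ-type closed forms 10 948 / 15 320 / 13 071 (kernel: `trg_descr_subwindow_ncard` — canonical
lowest-terms tuples; 39 339 on the segment)». Here:
* `exists_canon_prim_of_mem_trgFullFamily` — every member of `trgFullFamily 17 32` is the value of a canonical
  LOWEST-TERMS description (the landed canonical form, then divide `p, q` by their gcd);
* **`trg_value_injOn`** — on the certified segment the map description ↦ value is injective on canonical lowest-terms
  descriptions (`trg_descr_separated`: two distinct ones are `≥ dT/distU > 0` apart);
* **`trg_values_subwindow_ncard`** / **`trg_values_segment_ncard`** — the description counts ARE value counts: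
  `trgFullFamily 17 32` has exactly `10948 / 15320 / 13071` distinct VALUES in the three closed sub-windows and `39339`
  in the segment;
* **`trg_min_separation`** — two distinct `TRG` values in the segment differ by at least `dT/distU` (`≥ 53910·10⁻¹⁵`),
  and **`trg_min_separation_attained`** — the members `(28/9)·π^{−5/2}·Γ(⅓)²` and `(3/29)·π³/(Γ(¼)·log 2)` differ by
  at most `59213·10⁻¹⁵`: the minimum separation of the table on the segment is `5.39…5.93·10⁻¹¹` (bracket width = the
  landed `Γ` enclosures).
No relation among `π, e, log 2, ζ(3), ζ(5), G, Γ(¼), Γ(⅓)` is assumed: the statement is decided for this finite table on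
this segment by the certified enclosures — the landed TRG interval composition with `log 2` and `e` read at twenty digits from
the landed `Literature.Analysis.SpecialFunctions.Real.log_two_gt_d20 / _lt_d20` (`LogTwoBounds`) and Mathlib's
`Real.exp_one_near_20` (`trgGEnclT` of `…DistinctCoreTrg`: at the landed ten-digit `log 2` / nine-digit `e` a dozen consecutive pairs
do not separate); no constant is certified anew. A statement about the catalogue, NOT about `Δε`; nothing is recognised (§1.6).
lottery ticket; floor = tightest certified 3D Ising CFT bounds; no exact-solution claim without a proof.
-/

namespace Summit.CriticalPhenomena.Ising3D
namespace ColumnFaceL11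
open Set Literature.MathematicalPhysics.QuantumFieldTheory.ConformalBootstrap3D

/-! ### Every member has a canonical lowest-terms description -/

/-- **Canonical lowest-terms representative.** [folklore] -/
theorem exists_canon_prim_of_mem_trgFullFamily {x : ℝ} (hx : x ∈ trgFullFamily 17 32) :
    ∃ e : TrgTuple, trgGTupleOK 17 32 e = true ∧ trgCanon e = true ∧ trgPrim e = true ∧ x = trgGTupleVal e := by
  obtain ⟨e, hok, hcan, rfl⟩ := exists_canon_of_mem_trgFullFamily hx
  obtain ⟨p, q, u, a, g, b, L, s⟩ := e
  have hok' := hok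
  simp only [trgGTupleOK, Bool.and_eq_true, decide_eq_true_eq] at hok'
  obtain ⟨⟨⟨⟨⟨⟨⟨⟨⟨⟨⟨⟨⟨⟨hp1, hph⟩, hq1⟩, hqh⟩, hu⟩, hL⟩, hg⟩, ha1⟩, ha2⟩, hb1⟩, hb2⟩, hs1⟩, hs2⟩,
    hne⟩, hD⟩ := hok'
  set d := Nat.gcd p q with hd
  have hd0 : 0 < d := Nat.gcd_pos_of_pos_left _ (by omega)
  have hdp : d ∣ p := Nat.gcd_dvd_left _ _
  have hdq : d ∣ q := Nat.gcd_dvd_right _ _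
  refine ⟨(p / d, q / d, u, a, g, b, L, s), ?_, ?_, ?_, ?_⟩
  · simp only [trgGTupleOK, Bool.and_eq_true, decide_eq_true_eq]
    exact ⟨⟨⟨⟨⟨⟨⟨⟨⟨⟨⟨⟨⟨⟨Nat.div_pos (Nat.le_of_dvd (by omega) hdp) hd0, (Nat.div_le_self _ _).trans hph⟩,
      Nat.div_pos (Nat.le_of_dvd (by omega) hdq) hd0⟩, (Nat.div_le_self _ _).trans hqh⟩, hu⟩, hL⟩, hg⟩, ha1⟩, ha2⟩,
      hb1⟩, hb2⟩, hs1⟩, hs2⟩, hne⟩, hD⟩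
  · simpa [trgCanon] using hcan
  · simp only [trgPrim, beq_iff_eq]
    rw [hd]; exact Nat.coprime_div_gcd_div_gcd hd0
  · unfold trgGTupleVal
    simp only
    have hdR : (d : ℝ) ≠ 0 := by exact_mod_cast hd0.ne'
    have hq0 : (q : ℝ) ≠ 0 := by exact_mod_cast (show q ≠ 0 by omega)
    rw [Nat.cast_div hdp hdR, Nat.cast_div hdq hdR]
    field_simp

/-! ### Injectivity, value counts, minimum separation -/

/-- **Injectivity of description ↦ value** on canonical lowest-terms descriptions with value in the segment. [folklore] -/
theorem trg_value_injOn : Set.InjOn trgGTupleVal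
    {e : TrgTuple | trgGTupleOK 17 32 e = true ∧ trgCanon e = true ∧ trgPrim e = true ∧
      (81 / 64 : ℝ) ≤ trgGTupleVal e ∧ trgGTupleVal e ≤ 2855 / 2048} := by
  intro e he e' he' hv
  obtain ⟨hok, hcan, hprim, h1, h2⟩ := he
  obtain ⟨hok', hcan', hprim', h1', h2'⟩ := he'
  by_contra hne
  have hsep := trg_descr_separated hok hcan hprim hok' hcan' hprim' hne h1 h2 h1' h2'
  rw [hv, sub_self, abs_zero] at hsep
  have hpos : (0 : ℝ) < (dT : ℝ) / distU := div_pos (by unfold dT; norm_num) distU_pos.1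
  linarith

/-- **Minimum separation of `TRG` values on the segment**: two distinct members of `trgFullFamily 17 32` in
`[81/64, 2855/2048]` differ by at least `dT/distU = 5.3910…·10⁻¹¹`. [folklore] -/
theorem trg_min_separation {x y : ℝ} (hx : x ∈ trgFullFamily 17 32) (hy : y ∈ trgFullFamily 17 32)
    (hx1 : (81 / 64 : ℝ) ≤ x) (hx2 : x ≤ 2855 / 2048) (hy1 : (81 / 64 : ℝ) ≤ y) (hy2 : y ≤ 2855 / 2048)
    (hne : x ≠ y) : (dT : ℝ) / distU ≤ |x - y| := by
  obtain ⟨e, hok, hcan, hprim, rfl⟩ := exists_canon_prim_of_mem_trgFullFamily hx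
  obtain ⟨e', hok', hcan', hprim', rfl⟩ := exists_canon_prim_of_mem_trgFullFamily hy
  have hne' : e ≠ e' := by
    intro h; apply hne; rw [h]
  exact trg_descr_separated hok hcan hprim hok' hcan' hprim' hne' hx1 hx2 hy1 hy2

/-- Decimal form: distinct `TRG` values on the segment differ by more than `53910·10⁻¹⁵`. [folklore] -/
theorem trg_min_separation_decimal {x y : ℝ} (hx : x ∈ trgFullFamily 17 32) (hy : y ∈ trgFullFamily 17 32)
    (hx1 : (81 / 64 : ℝ) ≤ x) (hx2 : x ≤ 2855 / 2048) (hy1 : (81 / 64 : ℝ) ≤ y) (hy2 : y ≤ 2855 / 2048)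
    (hne : x ≠ y) : (53910 : ℝ) / 10 ^ 15 ≤ |x - y| := by
  refine le_trans ?_ (trg_min_separation hx hy hx1 hx2 hy1 hy2 hne)
  rw [div_le_div_iff₀ (by norm_num) distU_pos.1]
  unfold dT distU linS lcm32; norm_num

/-- The members of `trgFullFamily 17 32` in a closed window are exactly the values of the canonical lowest-terms
descriptions with value there. [folklore] -/
theorem trg_values_eq_image (lo hi : ℝ) :
    trgFullFamily 17 32 ∩ Set.Icc lo hi = trgGTupleVal ''
      {e : TrgTuple | trgGTupleOK 17 32 e = true ∧ trgCanon e = true ∧ trgPrim e = true ∧ lo ≤ trgGTupleVal e ∧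
        trgGTupleVal e ≤ hi} := by
  ext x
  constructor
  · rintro ⟨hx, h1, h2⟩
    obtain ⟨e, hok, hcan, hprim, rfl⟩ := exists_canon_prim_of_mem_trgFullFamily hx
    exact ⟨e, ⟨hok, hcan, hprim, h1, h2⟩, rfl⟩
  · rintro ⟨e, ⟨hok, -, -, h1, h2⟩, rfl⟩
    exact ⟨mem_trgFullFamily_of_trgGTupleOK hok, h1, h2⟩

/-- Counting values in a window inside the segment = counting canonical lowest-terms descriptions. [folklore] -/
theorem trg_values_ncard_eq {lo hi : ℝ} (hlo : (81 / 64 : ℝ) ≤ lo) (hhi : hi ≤ 2855 / 2048) :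
    (trgFullFamily 17 32 ∩ Set.Icc lo hi).ncard =
      {e : TrgTuple | trgGTupleOK 17 32 e = true ∧ trgCanon e = true ∧ trgPrim e = true ∧ lo ≤ trgGTupleVal e ∧
        trgGTupleVal e ≤ hi}.ncard := by
  rw [trg_values_eq_image]
  apply Set.InjOn.ncard_image
  refine Set.InjOn.mono (fun e he => ?_) trg_value_injOn
  simp only [Set.mem_setOf_eq] at he ⊢
  exact ⟨he.1, he.2.1, he.2.2.1, hlo.trans he.2.2.2.1, he.2.2.2.2.trans hhi⟩

/-- **The §7.3 `TRG` census numbers are VALUE counts**: `trgFullFamily 17 32` has exactly `10948`, `15320`, `13071`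
distinct values in the closed sub-windows `[81/64, 13/10]`, `[13/10, 27/20]`, `[27/20, 2855/2048]`. [folklore] -/
theorem trg_values_subwindow_ncard :
    (trgFullFamily 17 32 ∩ Set.Icc (81 / 64 : ℝ) (13 / 10)).ncard = 10948 ∧
    (trgFullFamily 17 32 ∩ Set.Icc (13 / 10 : ℝ) (27 / 20)).ncard = 15320 ∧
    (trgFullFamily 17 32 ∩ Set.Icc (27 / 20 : ℝ) (2855 / 2048)).ncard = 13071 := by
  obtain ⟨h0, h1, h2⟩ := trg_descr_subwindow_ncard
  have c0 : ((segCutQ 0 : ℚ) : ℝ) = 81 / 64 := by norm_num [segCutQ]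
  have c1 : ((segCutQ 1 : ℚ) : ℝ) = 13 / 10 := by norm_num [segCutQ]
  have c2 : ((segCutQ 2 : ℚ) : ℝ) = 27 / 20 := by norm_num [segCutQ]
  have c3 : ((segCutQ 3 : ℚ) : ℝ) = 2855 / 2048 := by norm_num [segCutQ]
  rw [c0, c1] at h0; rw [c1, c2] at h1; rw [c2, c3] at h2
  refine ⟨?_, ?_, ?_⟩
  · rw [trg_values_ncard_eq (by norm_num) (by norm_num)]; exact h0
  · rw [trg_values_ncard_eq (by norm_num) (by norm_num)]; exact h1
  · rw [trg_values_ncard_eq (by norm_num) (by norm_num)]; exact h2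

/-- **On the whole certified segment: `trgFullFamily 17 32` has exactly `39339` distinct values.** [folklore] -/
theorem trg_values_segment_ncard : (trgFullFamily 17 32 ∩ Set.Icc (81 / 64 : ℝ) (2855 / 2048)).ncard = 39339 := by
  have h := trg_descr_segment_ncard
  have c0 : ((segCutQ 0 : ℚ) : ℝ) = 81 / 64 := by norm_num [segCutQ]
  have c3 : ((segCutQ 3 : ℚ) : ℝ) = 2855 / 2048 := by norm_num [segCutQ]
  rw [c0, c3] at h
  rw [trg_values_ncard_eq (by norm_num) (by norm_num)]; exact h

/-! ### The minimum separation is attained (sharpness) -/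

/-- The left member of the closest `TRG` pair: `x = (28/9)·π^{−5/2}·Γ(⅓)² = 1.28097…`
(`(p, q, u, a, g, b, L, s) = (28, 9, 0, −5, 1, 2, 0, 0)`). [folklore] -/
def trgSepX : TrgTuple := (28, 9, 0, -5, 1, 2, 0, 0)

/-- The right member of the closest `TRG` pair: `y = (3/29)·π³·Γ(¼)⁻¹/log 2 = 1.28097…`
(`(3, 29, 0, 6, 0, −1, 0, −1)`). [folklore] -/
def trgSepY : TrgTuple := (3, 29, 0, 6, 0, -1, 0, -1)

/-- Kernel arithmetic on the two enclosures: both inside the scaled segment, `x` strictly below `y`, and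
`y.hi − x.lo ≤ 8550494350502391487200` (`= 5.9212…·10⁻¹¹ · distU`). [folklore] -/
theorem trgSep_encl :
    segLo ≤ (trgEncOf trgSepX).1 ∧ (trgEncOf trgSepY).2.1 ≤ segHi ∧
      (trgEncOf trgSepX).2.1 < (trgEncOf trgSepY).1 ∧
      (trgEncOf trgSepY).2.1 ≤ (trgEncOf trgSepX).1 + 8550494350502391487200 := by
  refine ⟨?_, ?_, ?_, ?_⟩ <;> decide +kernel

/-- `trgEncOf_sound` for a tuple variable. [folklore] -/
theorem trgEncOf_sound' (e : TrgTuple) (hq1 : 1 ≤ e.2.1) (hq2 : e.2.1 ≤ 32) :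
    (((trgEncOf e).1 : ℕ) : ℝ) ≤ (distU : ℝ) * trgGTupleVal e ∧ (distU : ℝ) * trgGTupleVal e ≤ (((trgEncOf e).2.1 : ℕ) : ℝ) := by
  obtain ⟨p, q, u, a, g, b, L, s⟩ := e
  exact trgEncOf_sound p hq1 hq2 u a g b L s

/-- **The minimum separation is attained**: the members `(28/9)·π^{−5/2}·Γ(⅓)² < (3/29)·π³/(Γ(¼)·log 2)` of
`trgFullFamily 17 32` lie in the segment and differ by at most `59213·10⁻¹⁵` — with `trg_min_separation` the minimum
distance between two values of the table on `[81/64, 2855/2048]` is `5.39…5.93·10⁻¹¹`. [folklore] -/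
theorem trg_min_separation_attained :
    trgGTupleVal trgSepX ∈ trgFullFamily 17 32 ∧ trgGTupleVal trgSepY ∈ trgFullFamily 17 32 ∧
      (81 / 64 : ℝ) ≤ trgGTupleVal trgSepX ∧ trgGTupleVal trgSepY ≤ 2855 / 2048 ∧
      trgGTupleVal trgSepX < trgGTupleVal trgSepY ∧
      trgGTupleVal trgSepY - trgGTupleVal trgSepX ≤ (59213 : ℝ) / 10 ^ 15 := by
  obtain ⟨e1, e2, e3, e4⟩ := trgSep_encl
  obtain ⟨hx1, hx2⟩ := trgEncOf_sound' trgSepX (by decide) (by decide)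
  obtain ⟨hy1, hy2⟩ := trgEncOf_sound' trgSepY (by decide) (by decide)
  have e1' : ((segLo : ℕ) : ℝ) ≤ (((trgEncOf trgSepX).1 : ℕ) : ℝ) := by exact_mod_cast e1
  have e2' : (((trgEncOf trgSepY).2.1 : ℕ) : ℝ) ≤ ((segHi : ℕ) : ℝ) := by exact_mod_cast e2
  have e3' : (((trgEncOf trgSepX).2.1 : ℕ) : ℝ) < (((trgEncOf trgSepY).1 : ℕ) : ℝ) := by exact_mod_cast e3
  have e4' : (((trgEncOf trgSepY).2.1 : ℕ) : ℝ) ≤ (((trgEncOf trgSepX).1 : ℕ) : ℝ) + 8550494350502391487200 := by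
    exact_mod_cast e4
  rw [segLo_eq] at e1'
  rw [segHi_eq] at e2'
  have hUv : (distU : ℝ) = 144403552893600000000000000000000 := by unfold distU linS lcm32; norm_num
  rw [hUv] at e1' e2' hx1 hx2 hy1 hy2
  generalize (((trgEncOf trgSepX).1 : ℕ) : ℝ) = A at *
  generalize (((trgEncOf trgSepX).2.1 : ℕ) : ℝ) = B at *
  generalize (((trgEncOf trgSepY).1 : ℕ) : ℝ) = C at *
  generalize (((trgEncOf trgSepY).2.1 : ℕ) : ℝ) = D at *
  refine ⟨mem_trgFullFamily_of_trgGTupleOK (by decide), mem_trgFullFamily_of_trgGTupleOK (by decide), ?_, ?_, ?_, ?_⟩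
  · linarith
  · linarith
  · linarith
  · linarith

end ColumnFaceL11
end Summit.CriticalPhenomena.Ising3D
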